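import Summits.KontsevichZagierPeriods.Zeta5Search.Barrier.ConeGammaPeriodDigamma

/-!
# ζ(5) search — BARRIER: the breakpoints of `u ↦ N_a(u)` on a period, and breakpoint data for the period formula

HONEST FRAMING (cell `pub-zeta5`): systematic search; no irrationality claim unless kernel-certified. MODEL objects
under Brown–Zudilin's (28)+(30) accounting ([BZ22] = arXiv:2210.03391); nothing here is a statement about `ζ(5)`;
records in print UNMOVED. Infrastructure for `BARRIER-PLAN.md` §2b (P3) (theory seat cert-2 g17, WAKE w3 of
lead/lit g23): the exact period formula of `ConeGammaPeriod`/`ConeGammaPeriodDigamma` takes the breakpoints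
`b_m` and gap values `c_m` of one period as INPUT; this file shows that such data always EXIST (so the formula is
unconditional in shape) and records the mechanism:

* `exists_h28_eq_permAct` — every form of a permuted direction `σ·a` is one of the 28 forms of `a`; hence
  `savingN_congr_floor`: `N_a(u)` depends on `u` only through the 28 integers `⌊h_k(a) u⌋`;
* `bkpts a T` — the finite set `{0, T} ∪ {z/h_k(a) ∈ [0,T] : z ∈ ℤ}`; `savingN_eq_of_no_bkpt` — `N_a` is constant
  on any interval `[u, u'] ⊂ [0, T]` containing no breakpoint in `(u, u']` (right-continuity of the floors);
* `bkpt a T m` — the increasing enumeration of `bkpts a T` (via `Finset.orderEmbOfFin`), `bkpt_zero`, `bkpt_last`,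
  `bkpt_strictMono`, `savingN_Ico_bkpt` (constancy on `[b_m, b_{m+1})`), and the packaged
  **`exists_breakpoint_data`**: for every `a` in the closed box and `T > 0` there are `M`, strictly increasing
  `b₀ = 0 < ⋯ < b_M = T` and integers `c_m` with `N_a ≡ c_m` on `[b_m, b_{m+1})`.
-/

noncomputable section

open Set

namespace Summit.KontsevichZagierPeriods.Zeta5Search.Barrier.ConeGamma

/-! ### `N_a(u)` is a function of the 28 floors `⌊h_k(a)u⌋` -/

/-- A pair form with distinct indices is one of the 28 tabulated forms. -/
theorem exists_phiForm_eq_pairForm (θ : Fin 8 → ℝ) {i j : Fin 8} (hij : i ≠ j) :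
    ∃ k : Fin 28, pairForm θ i j = phiForm θ k := by
  rcases lt_or_gt_of_ne hij with h | h
  · exact ⟨idxOf i j, pairForm_eq_phiForm_idxOf θ h⟩
  · exact ⟨idxOf j i, by rw [pairForm_comm, pairForm_eq_phiForm_idxOf θ h]⟩

/-- **Every form of `σ·a` is a form of `a`**: `h_i(σa) = h_k(a)` for some `k`. -/
theorem exists_h28_eq_permAct (a : Dir) (σ : Equiv.Perm (Fin 7)) (i : Fin 28) :
    ∃ k : Fin 28, h28 (permAct σ a) i = h28 a k := by
  have h1 : h28 (permAct σ a) i = phiForm (permS σ ((1 : ℝ) • sParam a)) i := by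
    rw [phiForm_permS_smul_sParam, one_mul]
  rw [h1, one_smul, phiForm_permS]
  obtain ⟨k, hk⟩ := exists_phiForm_eq_pairForm (sParam a)
    ((liftPerm σ).injective.ne (fstIdx_ne_sndIdx i))
  refine ⟨k, ?_⟩
  rw [hk, ← one_mul (h28 a k), ← phiForm_smul_sParam, one_smul]

open scoped Classical in
/-- **`N_a(u)` depends on `u` only through the floors `⌊h_k(a)u⌋`, `k < 28`.** -/
theorem savingN_congr_floor {a : Dir} {u u' : ℝ} (h : ∀ k : Fin 28, ⌊h28 a k * u⌋ = ⌊h28 a k * u'⌋) :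
    savingN a u = savingN a u' := by
  unfold savingN
  congr 1
  ext σ
  unfold savingTerm
  split_ifs
  · refine Finset.sum_congr rfl fun i _ => ?_
    obtain ⟨k, hk⟩ := exists_h28_eq_permAct a σ i
    rw [h i, hk, h k]
  · rfl

/-! ### The breakpoint set of `[0, T]` -/

/-- The breakpoints of `u ↦ N_a(u)` on `[0, T]` (a superset of them): `0`, `T`, and the points `z/h_k(a) ∈ [0,T]`,
`z ∈ ℤ`, where some floor `⌊h_k u⌋` jumps. -/
def bkpts (a : Dir) (T : ℝ) : Finset ℝ :=
  (insert 0 (insert T ((Finset.univ : Finset (Fin 28)).biUnion fun k =>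
    (Finset.Icc (0 : ℤ) ⌈T * h28 a k⌉).image fun z : ℤ => (z : ℝ) / h28 a k))).filter
    fun x => 0 ≤ x ∧ x ≤ T

/-- Breakpoints lie in `[0, T]`. -/
theorem mem_bkpts_bounds {a : Dir} {T x : ℝ} (hx : x ∈ bkpts a T) : 0 ≤ x ∧ x ≤ T :=
  (Finset.mem_filter.mp hx).2

/-- `0` is a breakpoint (for `T ≥ 0`). -/
theorem zero_mem_bkpts (a : Dir) {T : ℝ} (hT : 0 ≤ T) : (0 : ℝ) ∈ bkpts a T :=
  Finset.mem_filter.mpr ⟨Finset.mem_insert_self _ _, le_rfl, hT⟩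

/-- `T` is a breakpoint (for `T ≥ 0`). -/
theorem self_mem_bkpts (a : Dir) {T : ℝ} (hT : 0 ≤ T) : T ∈ bkpts a T :=
  Finset.mem_filter.mpr ⟨Finset.mem_insert_of_mem (Finset.mem_insert_self _ _), hT, le_rfl⟩

/-- A jump point `z/h_k ∈ [0, T]` (`h_k > 0`, `z ∈ ℤ`, `z ≥ 0`) is a breakpoint. -/
theorem div_mem_bkpts {a : Dir} {T : ℝ} {k : Fin 28} (hk : 0 < h28 a k) {z : ℤ} (hz0 : 0 ≤ z)
    (hzT : (z : ℝ) / h28 a k ≤ T) : (z : ℝ) / h28 a k ∈ bkpts a T := by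
  refine Finset.mem_filter.mpr ⟨?_, div_nonneg (by exact_mod_cast hz0) hk.le, hzT⟩
  refine Finset.mem_insert_of_mem (Finset.mem_insert_of_mem ?_)
  refine Finset.mem_biUnion.mpr ⟨k, Finset.mem_univ _, Finset.mem_image.mpr ⟨z, ?_, rfl⟩⟩
  refine Finset.mem_Icc.mpr ⟨hz0, ?_⟩
  have hzle : (z : ℝ) ≤ T * h28 a k := by rwa [div_le_iff₀ hk] at hzT
  exact_mod_cast hzle.trans (Int.le_ceil _)

/-- **Right-continuous constancy**: if `0 ≤ u ≤ u' ≤ T` and no breakpoint lies in `(u, u']`, then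
`N_a(u') = N_a(u)` (`a` in the closed box, so every `h_k ≥ 0`). -/
theorem savingN_eq_of_no_bkpt {a : Dir} (ha : BZBox a) {T u u' : ℝ} (hu : 0 ≤ u) (huu' : u ≤ u')
    (hu'T : u' ≤ T) (hno : ∀ x ∈ bkpts a T, ¬(u < x ∧ x ≤ u')) : savingN a u' = savingN a u := by
  refine savingN_congr_floor fun k => ?_
  rcases (h28_nonneg_of_BZBox ha k).eq_or_lt with hk | hk
  · rw [← hk]; simp
  · apply le_antisymm _ (Int.floor_le_floor (mul_le_mul_of_nonneg_left huu' hk.le))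
    by_contra hlt
    push Not at hlt
    set z : ℤ := ⌊h28 a k * u'⌋ with hz
    have hz1 : h28 a k * u < z := by
      have := Int.lt_floor_add_one (h28 a k * u)
      have h2 : (⌊h28 a k * u⌋ : ℝ) + 1 ≤ z := by exact_mod_cast hlt
      linarith
    have hz2 : (z : ℝ) ≤ h28 a k * u' := Int.floor_le _
    have hz0 : 0 ≤ z := by
      have : (0 : ℝ) ≤ h28 a k * u := mul_nonneg hk.le hu
      exact_mod_cast (this.trans_lt hz1).le
    have hx1 : u < (z : ℝ) / h28 a k := by rw [lt_div_iff₀ hk]; linarith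
    have hx2 : (z : ℝ) / h28 a k ≤ u' := by rw [div_le_iff₀ hk]; linarith
    exact hno _ (div_mem_bkpts hk hz0 (hx2.trans hu'T)) ⟨hx1, hx2⟩

/-! ### The increasing enumeration -/

/-- The `m`-th breakpoint of `[0, T]` in increasing order (`= T` past the end). -/
def bkpt (a : Dir) (T : ℝ) (m : ℕ) : ℝ :=
  if h : m < (bkpts a T).card then (bkpts a T).orderEmbOfFin rfl ⟨m, h⟩ else T

/-- There are at least two breakpoints (`0` and `T`) when `T > 0`. -/
theorem two_le_card_bkpts (a : Dir) {T : ℝ} (hT : 0 < T) : 2 ≤ (bkpts a T).card := by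
  have h : ({0, T} : Finset ℝ) ⊆ bkpts a T := by
    intro x hx
    rcases Finset.mem_insert.mp hx with rfl | hx
    · exact zero_mem_bkpts a hT.le
    · rw [Finset.mem_singleton.mp hx]; exact self_mem_bkpts a hT.le
  have hc : ({0, T} : Finset ℝ).card = 2 := Finset.card_pair hT.ne
  exact hc ▸ Finset.card_le_card h

/-- In range, `bkpt` is the order embedding. -/
theorem bkpt_eq {a : Dir} {T : ℝ} {m : ℕ} (hm : m < (bkpts a T).card) :
    bkpt a T m = (bkpts a T).orderEmbOfFin rfl ⟨m, hm⟩ := by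
  simp [bkpt, hm]

/-- In range, `bkpt a T m` is a breakpoint. -/
theorem bkpt_mem {a : Dir} {T : ℝ} {m : ℕ} (hm : m < (bkpts a T).card) : bkpt a T m ∈ bkpts a T := by
  rw [bkpt_eq hm]; exact Finset.orderEmbOfFin_mem _ _ _

/-- `b₀ = 0`. -/
theorem bkpt_zero (a : Dir) {T : ℝ} (hT : 0 < T) : bkpt a T 0 = 0 := by
  have hc := two_le_card_bkpts a hT
  rw [bkpt_eq (by omega), Finset.orderEmbOfFin_zero _ (by omega)]
  apply le_antisymm
  · exact Finset.min'_le _ _ (zero_mem_bkpts a hT.le)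
  · exact Finset.le_min' _ _ _ fun x hx => (mem_bkpts_bounds hx).1

/-- `b_M = T` for `M = #bkpts − 1`. -/
theorem bkpt_last (a : Dir) {T : ℝ} (hT : 0 < T) : bkpt a T ((bkpts a T).card - 1) = T := by
  have hc := two_le_card_bkpts a hT
  rw [bkpt_eq (by omega), Finset.orderEmbOfFin_last _ (by omega)]
  apply le_antisymm
  · exact Finset.max'_le _ _ _ fun x hx => (mem_bkpts_bounds hx).2
  · exact Finset.le_max' _ _ (self_mem_bkpts a hT.le)

/-- The enumeration is strictly increasing in range. -/
theorem bkpt_strictMono {a : Dir} {T : ℝ} {m m' : ℕ} (hmm' : m < m') (hm' : m' < (bkpts a T).card) :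
    bkpt a T m < bkpt a T m' := by
  rw [bkpt_eq (hmm'.trans hm'), bkpt_eq hm']
  exact (Finset.orderEmbOfFin _ _).strictMono (Fin.mk_lt_mk.mpr hmm')

/-- No breakpoint lies strictly between consecutive enumerated breakpoints. -/
theorem no_bkpt_between {a : Dir} {T : ℝ} {m : ℕ} (hm : m + 1 < (bkpts a T).card) {x : ℝ}
    (hx : x ∈ bkpts a T) (h1 : bkpt a T m < x) : bkpt a T (m + 1) ≤ x := by
  have hrange := Finset.range_orderEmbOfFin (bkpts a T) rfl
  have hx' : x ∈ Set.range ((bkpts a T).orderEmbOfFin rfl) := by rw [hrange]; exact hx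
  obtain ⟨i, hi⟩ := hx'
  rw [bkpt_eq (by omega)] at h1
  rw [bkpt_eq hm, ← hi]
  rw [← hi] at h1
  have him : (⟨m, by omega⟩ : Fin (bkpts a T).card) < i :=
    ((Finset.orderEmbOfFin _ _).strictMono.lt_iff_lt).mp h1
  exact ((Finset.orderEmbOfFin _ _).strictMono.le_iff_le).mpr (Fin.mk_le_of_le_val (by
    have : (m : ℕ) < i.val := him
    omega))

/-- **Constancy on `[b_m, b_{m+1})`**: `N_a(u) = N_a(b_m)` there. -/
theorem savingN_Ico_bkpt {a : Dir} (ha : BZBox a) {T : ℝ} {m : ℕ}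
    (hm : m + 1 < (bkpts a T).card) {u : ℝ} (hu : u ∈ Set.Ico (bkpt a T m) (bkpt a T (m + 1))) :
    savingN a u = savingN a (bkpt a T m) := by
  have hbm := mem_bkpts_bounds (bkpt_mem (a := a) (T := T) (m := m) (by omega))
  have hbm1 := mem_bkpts_bounds (bkpt_mem (a := a) (T := T) (m := m + 1) hm)
  refine savingN_eq_of_no_bkpt ha (T := T) hbm.1 hu.1 (hu.2.le.trans hbm1.2) fun x hx hux => ?_
  have := no_bkpt_between hm hx hux.1
  linarith [hu.2, hux.2]

/-- **Breakpoint data exist (P3 made unconditional in shape)**: for `a` in the closed box and `T > 0` there are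
`M`, breakpoints `0 = b₀ < b₁ < ⋯ < b_M = T` and integers `c_m` with `N_a ≡ c_m` on `[b_m, b_{m+1})`
(right-closed at `b_m`: the floors are right-continuous). -/
theorem exists_breakpoint_data {a : Dir} (ha : BZBox a) {T : ℝ} (hT : 0 < T) :
    ∃ (M : ℕ) (b : ℕ → ℝ) (c : ℕ → ℤ), b 0 = 0 ∧ b M = T ∧ (∀ m < M, b m < b (m + 1)) ∧
      ∀ m < M, ∀ u ∈ Set.Ico (b m) (b (m + 1)), savingN a u = c m := by
  have hc := two_le_card_bkpts a hT
  refine ⟨(bkpts a T).card - 1, bkpt a T, fun m => savingN a (bkpt a T m), bkpt_zero a hT, bkpt_last a hT,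
    fun m hm => bkpt_strictMono (Nat.lt_succ_self m) (by omega), fun m hm u hu => ?_⟩
  exact savingN_Ico_bkpt ha (by omega) hu

/-- **The exact period formula with no data hypotheses** (digamma form, existential breakpoints): for `a` in the
closed box with period `T` there are strict breakpoints and gap values as above for which
`Φ(a) = (Σ_{1≤m<M} c_m (ψ(b_{m+1}/T) − ψ(b_m/T)))/T`. -/
theorem exists_phi30_eq_digammaSum {a : Dir} (ha : BZBox a) {T : ℝ} (hT : 0 < T)
    (hper : ∀ k : Fin 28, ∃ z : ℤ, T * h28 a k = z) :
    ∃ (M : ℕ) (b : ℕ → ℝ) (c : ℕ → ℤ), b 0 = 0 ∧ b M = T ∧ (∀ m < M, b m < b (m + 1)) ∧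
      (∀ m < M, ∀ u ∈ Set.Ico (b m) (b (m + 1)), savingN a u = c m) ∧
      phi30 a = (∑ m ∈ Finset.Ico 1 M, (c m : ℝ) *
        (Complex.digamma ((b (m + 1) / T : ℝ) : ℂ) - Complex.digamma ((b m / T : ℝ) : ℂ)).re) / T := by
  obtain ⟨M, b, c, hb0, hbM, hb, hcst⟩ := exists_breakpoint_data ha hT
  exact ⟨M, b, c, hb0, hbM, hb, hcst, phi30_eq_digammaSum ha hT hper hb0 hbM hb
    fun m hm u hu => hcst m hm u (Set.Ioo_subset_Ico_self hu)⟩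

end Summit.KontsevichZagierPeriods.Zeta5Search.Barrier.ConeGamma

end
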